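import Mathlib
import HarnessLib
import Summits.NavierStokesRegularity.NavierStokesRegularity.Theorems.ThreadingFluxHorizonTowerCubicCertNumerator
import Summits.NavierStokesRegularity.NavierStokesRegularity.Theorems.ThreadingFluxHorizonTowerCubicCertZonal

/-!
# Crux `PoloidalLiouville` (stmt-NavierStokesRegularity-1222, wall W1), crux idea «horizon-threading-tower» (ns-idea-15):
# the l = 3 certificate core — from the vanishing of the numerator FUNCTION to the 28 coefficient equations

HONEST LABEL as in the sibling files (certificate core of the l = 3 cell of `HorizonTower.HorizonZonalitySingleDegree`, not that
statement by name; the identification `‖x‖⁶·𝔏₂[U_{H_a}] = horizonNumerator a` is ENGINE-certified only, DATUM B-ht1).  This file closes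
the small formal gap between what an identification theorem would deliver — the numerator VANISHES AS A FUNCTION off the origin — and
the hypothesis of the certificate (`∀ j, gens a j = 0`):

* `CubicCert.gens_eq_zero_of_horizonNumerator_eq_zero` — `(∀ x y z, horizonNumerator a x y z = 0) → ∀ j, gens a j = 0`
  (Kronecker substitution `(x,y,z) = (1, t, t⁷)` turns the 28 degree-6 monomials into DISTINCT powers `t^{j+7k}`; a real polynomial
  vanishing everywhere is zero (`Polynomial.funext`); read off the coefficients);
* `CubicCert.gens_eq_zero_of_horizonNumerator_eq_zero_off_origin` — the same from vanishing at the points `p ≠ 0` of `ℝ³` only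
  (the numerator has no constant term);
* `CubicCert.zonalForm_of_horizonNumerator_eq_zero` — composed with `zonalForm_of_gensVanish`: numerator ≡ 0 off the origin ⇒
  `∃ n ≠ 0, ∃ g, ∀ y ≠ 0, cubicHE3 a y = ‖y‖³ g(⟪n,y⟫/‖y‖)`.

So the BY-NAME l = 3 theorem now needs exactly: (i) smooth + `c³`-homogeneous + harmonic `H` is `cubicHE3 a` for some `a`, and (ii) the
identification identity.  Information-grade for W1/W2; `PoloidalLiouville` (1222) / NS regularity OPEN and untouched.  Seat ns-wall-eng-7 g3,
cell ns-wall-extremal; `--supports stmt-NavierStokesRegularity-1222 --as helper`.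
-/

-- the summit and its single problem share the name (D-0017 nested layout)
set_option linter.dupNamespace false

noncomputable section

open scoped RealInnerProductSpace

namespace Summit.NavierStokesRegularity.NavierStokesRegularity.Theorems.PoloidalLiouville.HorizonTower.CubicCert

/-- If the numerator `N(a; ·)` vanishes identically on `ℝ³` then all 28 coefficient forms vanish at `a`. -/
theorem gens_eq_zero_of_horizonNumerator_eq_zero (a : Fin 7 → ℝ) (h : ∀ x y z : ℝ, horizonNumerator a x y z = 0) :
    ∀ j : Fin 28, gens a j = 0 := by
  -- Kronecker substitution (x, y, z) = (1, t, t⁷): the monomial xⁱ yʲ zᵏ becomes t^(j + 7k), all 28 exponents distinct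
  set q : Polynomial ℝ :=
      Polynomial.C ((80 : ℝ) * gens a 9) * Polynomial.X ^ 0 + Polynomial.C ((-160 : ℝ) * gens a 13) * Polynomial.X ^ 1 +
      Polynomial.C ((160 : ℝ) * gens a 0) * Polynomial.X ^ 7 + Polynomial.C ((80 : ℝ) * gens a 11) * Polynomial.X ^ 2 +
      Polynomial.C ((-160 : ℝ) * gens a 5) * Polynomial.X ^ 8 + Polynomial.C ((-80 : ℝ) * gens a 6) * Polynomial.X ^ 14 +
      Polynomial.C ((-320 : ℝ) * gens a 23) * Polynomial.X ^ 3 + Polynomial.C ((-320 : ℝ) * gens a 1) * Polynomial.X ^ 9 +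
      Polynomial.C ((320 : ℝ) * gens a 12) * Polynomial.X ^ 15 + Polynomial.C ((-320 : ℝ) * gens a 17) * Polynomial.X ^ 21 +
      Polynomial.C ((-80 : ℝ) * gens a 8) * Polynomial.X ^ 4 + Polynomial.C ((-320 : ℝ) * gens a 4) * Polynomial.X ^ 10 +
      Polynomial.C ((1440 : ℝ) * gens a 10) * Polynomial.X ^ 16 + Polynomial.C ((320 : ℝ) * gens a 19) * Polynomial.X ^ 22 +
      Polynomial.C ((-80 : ℝ) * gens a 21) * Polynomial.X ^ 28 + Polynomial.C ((-160 : ℝ) * gens a 15) * Polynomial.X ^ 5 +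
      Polynomial.C ((-160 : ℝ) * gens a 2) * Polynomial.X ^ 11 + Polynomial.C ((-320 : ℝ) * gens a 14) * Polynomial.X ^ 17 +
      Polynomial.C ((320 : ℝ) * gens a 18) * Polynomial.X ^ 23 + Polynomial.C ((320 : ℝ) * gens a 24) * Polynomial.X ^ 29 +
      Polynomial.C ((640 : ℝ) * gens a 25) * Polynomial.X ^ 35 + Polynomial.C ((-80 : ℝ) * gens a 16) * Polynomial.X ^ 6 +
      Polynomial.C ((160 : ℝ) * gens a 3) * Polynomial.X ^ 12 + Polynomial.C ((80 : ℝ) * gens a 7) * Polynomial.X ^ 18 +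
      Polynomial.C ((-320 : ℝ) * gens a 20) * Polynomial.X ^ 24 + Polynomial.C ((80 : ℝ) * gens a 22) * Polynomial.X ^ 30 +
      Polynomial.C ((-640 : ℝ) * gens a 26) * Polynomial.X ^ 36 + Polynomial.C ((-1280 : ℝ) * gens a 27) * Polynomial.X ^ 42 with hq_def
  have hq : ∀ t : ℝ, q.eval t = horizonNumerator a 1 t (t ^ 7) := by
    intro t
    simp only [q, Polynomial.eval_add, Polynomial.eval_mul, Polynomial.eval_C, Polynomial.eval_pow, Polynomial.eval_X]
    rw [horizonNumerator_eq]
    ring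
  have hq0 : q = 0 := by
    apply Polynomial.funext
    intro t
    rw [hq, h, Polynomial.eval_zero]
  have hcoeff : ∀ e : ℕ, q.coeff e = 0 := fun e => by rw [hq0, Polynomial.coeff_zero]
  intro j
  fin_cases j
  · -- j = 0: monomial x^5 y^0 z^1 ↦ X^7, content 160
    have hc := hcoeff 7
    simp only [q, Polynomial.coeff_add, Polynomial.coeff_C_mul, Polynomial.coeff_X_pow] at hc
    norm_num at hc
    exact hc
  · -- j = 1: monomial x^3 y^2 z^1 ↦ X^9, content -320
    have hc := hcoeff 9
    simp only [q, Polynomial.coeff_add, Polynomial.coeff_C_mul, Polynomial.coeff_X_pow] at hc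
    norm_num at hc
    exact hc
  · -- j = 2: monomial x^1 y^4 z^1 ↦ X^11, content -160
    have hc := hcoeff 11
    simp only [q, Polynomial.coeff_add, Polynomial.coeff_C_mul, Polynomial.coeff_X_pow] at hc
    norm_num at hc
    exact hc
  · -- j = 3: monomial x^0 y^5 z^1 ↦ X^12, content 160
    have hc := hcoeff 12
    simp only [q, Polynomial.coeff_add, Polynomial.coeff_C_mul, Polynomial.coeff_X_pow] at hc
    norm_num at hc
    exact hc
  · -- j = 4: monomial x^2 y^3 z^1 ↦ X^10, content -320
    have hc := hcoeff 10
    simp only [q, Polynomial.coeff_add, Polynomial.coeff_C_mul, Polynomial.coeff_X_pow] at hc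
    norm_num at hc
    exact hc
  · -- j = 5: monomial x^4 y^1 z^1 ↦ X^8, content -160
    have hc := hcoeff 8
    simp only [q, Polynomial.coeff_add, Polynomial.coeff_C_mul, Polynomial.coeff_X_pow] at hc
    norm_num at hc
    exact hc
  · -- j = 6: monomial x^4 y^0 z^2 ↦ X^14, content -80
    have hc := hcoeff 14
    simp only [q, Polynomial.coeff_add, Polynomial.coeff_C_mul, Polynomial.coeff_X_pow] at hc
    norm_num at hc
    exact hc
  · -- j = 7: monomial x^0 y^4 z^2 ↦ X^18, content 80
    have hc := hcoeff 18
    simp only [q, Polynomial.coeff_add, Polynomial.coeff_C_mul, Polynomial.coeff_X_pow] at hc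
    norm_num at hc
    exact hc
  · -- j = 8: monomial x^2 y^4 z^0 ↦ X^4, content -80
    have hc := hcoeff 4
    simp only [q, Polynomial.coeff_add, Polynomial.coeff_C_mul, Polynomial.coeff_X_pow] at hc
    norm_num at hc
    exact hc
  · -- j = 9: monomial x^6 y^0 z^0 ↦ X^0, content 80
    have hc := hcoeff 0
    simp only [q, Polynomial.coeff_add, Polynomial.coeff_C_mul, Polynomial.coeff_X_pow] at hc
    norm_num at hc
    exact hc
  · -- j = 10: monomial x^2 y^2 z^2 ↦ X^16, content 1440
    have hc := hcoeff 16
    simp only [q, Polynomial.coeff_add, Polynomial.coeff_C_mul, Polynomial.coeff_X_pow] at hc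
    norm_num at hc
    exact hc
  · -- j = 11: monomial x^4 y^2 z^0 ↦ X^2, content 80
    have hc := hcoeff 2
    simp only [q, Polynomial.coeff_add, Polynomial.coeff_C_mul, Polynomial.coeff_X_pow] at hc
    norm_num at hc
    exact hc
  · -- j = 12: monomial x^3 y^1 z^2 ↦ X^15, content 320
    have hc := hcoeff 15
    simp only [q, Polynomial.coeff_add, Polynomial.coeff_C_mul, Polynomial.coeff_X_pow] at hc
    norm_num at hc
    exact hc
  · -- j = 13: monomial x^5 y^1 z^0 ↦ X^1, content -160
    have hc := hcoeff 1
    simp only [q, Polynomial.coeff_add, Polynomial.coeff_C_mul, Polynomial.coeff_X_pow] at hc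
    norm_num at hc
    exact hc
  · -- j = 14: monomial x^1 y^3 z^2 ↦ X^17, content -320
    have hc := hcoeff 17
    simp only [q, Polynomial.coeff_add, Polynomial.coeff_C_mul, Polynomial.coeff_X_pow] at hc
    norm_num at hc
    exact hc
  · -- j = 15: monomial x^1 y^5 z^0 ↦ X^5, content -160
    have hc := hcoeff 5
    simp only [q, Polynomial.coeff_add, Polynomial.coeff_C_mul, Polynomial.coeff_X_pow] at hc
    norm_num at hc
    exact hc
  · -- j = 16: monomial x^0 y^6 z^0 ↦ X^6, content -80
    have hc := hcoeff 6
    simp only [q, Polynomial.coeff_add, Polynomial.coeff_C_mul, Polynomial.coeff_X_pow] at hc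
    norm_num at hc
    exact hc
  · -- j = 17: monomial x^3 y^0 z^3 ↦ X^21, content -320
    have hc := hcoeff 21
    simp only [q, Polynomial.coeff_add, Polynomial.coeff_C_mul, Polynomial.coeff_X_pow] at hc
    norm_num at hc
    exact hc
  · -- j = 18: monomial x^1 y^2 z^3 ↦ X^23, content 320
    have hc := hcoeff 23
    simp only [q, Polynomial.coeff_add, Polynomial.coeff_C_mul, Polynomial.coeff_X_pow] at hc
    norm_num at hc
    exact hc
  · -- j = 19: monomial x^2 y^1 z^3 ↦ X^22, content 320
    have hc := hcoeff 22
    simp only [q, Polynomial.coeff_add, Polynomial.coeff_C_mul, Polynomial.coeff_X_pow] at hc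
    norm_num at hc
    exact hc
  · -- j = 20: monomial x^0 y^3 z^3 ↦ X^24, content -320
    have hc := hcoeff 24
    simp only [q, Polynomial.coeff_add, Polynomial.coeff_C_mul, Polynomial.coeff_X_pow] at hc
    norm_num at hc
    exact hc
  · -- j = 21: monomial x^2 y^0 z^4 ↦ X^28, content -80
    have hc := hcoeff 28
    simp only [q, Polynomial.coeff_add, Polynomial.coeff_C_mul, Polynomial.coeff_X_pow] at hc
    norm_num at hc
    exact hc
  · -- j = 22: monomial x^0 y^2 z^4 ↦ X^30, content 80
    have hc := hcoeff 30
    simp only [q, Polynomial.coeff_add, Polynomial.coeff_C_mul, Polynomial.coeff_X_pow] at hc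
    norm_num at hc
    exact hc
  · -- j = 23: monomial x^3 y^3 z^0 ↦ X^3, content -320
    have hc := hcoeff 3
    simp only [q, Polynomial.coeff_add, Polynomial.coeff_C_mul, Polynomial.coeff_X_pow] at hc
    norm_num at hc
    exact hc
  · -- j = 24: monomial x^1 y^1 z^4 ↦ X^29, content 320
    have hc := hcoeff 29
    simp only [q, Polynomial.coeff_add, Polynomial.coeff_C_mul, Polynomial.coeff_X_pow] at hc
    norm_num at hc
    exact hc
  · -- j = 25: monomial x^1 y^0 z^5 ↦ X^35, content 640
    have hc := hcoeff 35
    simp only [q, Polynomial.coeff_add, Polynomial.coeff_C_mul, Polynomial.coeff_X_pow] at hc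
    norm_num at hc
    exact hc
  · -- j = 26: monomial x^0 y^1 z^5 ↦ X^36, content -640
    have hc := hcoeff 36
    simp only [q, Polynomial.coeff_add, Polynomial.coeff_C_mul, Polynomial.coeff_X_pow] at hc
    norm_num at hc
    exact hc
  · -- j = 27: monomial x^0 y^0 z^6 ↦ X^42, content -1280
    have hc := hcoeff 42
    simp only [q, Polynomial.coeff_add, Polynomial.coeff_C_mul, Polynomial.coeff_X_pow] at hc
    norm_num at hc
    exact hc

/-- The numerator has no constant term, so vanishing at the non-zero points of `ℝ³` is enough. -/
theorem gens_eq_zero_of_horizonNumerator_eq_zero_off_origin (a : Fin 7 → ℝ)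
    (h : ∀ p : E3, p ≠ 0 → horizonNumerator a (p 0) (p 1) (p 2) = 0) : ∀ j : Fin 28, gens a j = 0 := by
  apply gens_eq_zero_of_horizonNumerator_eq_zero
  intro x y z
  by_cases hx : (WithLp.toLp 2 ![x, y, z] : E3) = 0
  · have h3 : ![x, y, z] = 0 := (WithLp.toLp_eq_zero 2).mp hx
    have ex : x = 0 := by simpa using congrFun h3 0
    have ey : y = 0 := by simpa using congrFun h3 1
    have ez : z = 0 := by simpa using congrFun h3 2
    subst ex ey ez
    rw [horizonNumerator_eq]
    norm_num
  · simpa using h _ hx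

/-- ★ **Certificate core from the numerator (l = 3).**  If the engines' numerator of `‖x‖⁶·𝔏₂[U_{H_a}]` vanishes at every non-zero
point, then `H_a` has the zonal functional form about some non-zero axis — the conclusion of `HorizonZonalitySingleDegree` for
`l = 3`, `H = cubicHE3 a`, now modulo the identification identity ALONE. -/
theorem zonalForm_of_horizonNumerator_eq_zero (a : Fin 7 → ℝ)
    (h : ∀ p : E3, p ≠ 0 → horizonNumerator a (p 0) (p 1) (p 2) = 0) :
    ∃ (n : E3) (g : ℝ → ℝ), n ≠ 0 ∧ ∀ y : E3, y ≠ 0 → cubicHE3 a y = ‖y‖ ^ 3 * g (⟪n, y⟫ / ‖y‖) :=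
  zonalForm_of_gensVanish a (gens_eq_zero_of_horizonNumerator_eq_zero_off_origin a h)

end Summit.NavierStokesRegularity.NavierStokesRegularity.Theorems.PoloidalLiouville.HorizonTower.CubicCert

end
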